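import Literature.RepresentationTheory.ModularTensorCategories.KLRacahRecurrence

/-!
# Orthogonality of the Kauffman–Lins Racah sums from the two three-term recurrences (spectral argument)

Topic `Literature/RepresentationTheory/ModularTensorCategories` (toward `KLOrthogonality_holds`). The abstract
finite-dimensional "spectral" lemma `gram_eq_of_threeTerm`: if a matrix `T : I × J → F` intertwines a `w`-symmetric
operator on `I` with a diagonal one on `J` (injective eigenvalues), and a `u`-symmetric operator on `J` with a diagonal
one on `I`, has a nowhere-vanishing row `i₀`, and one column `j₀` of the right norm, then
`Σ_i w_i T_{ij} T_{ij'} = δ_{jj'}/u_j` (orthogonality by columns with the predicted norms; Gasper–Rahman §7.1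
(7.1.8)–(7.1.9) in finite form). Then the Kauffman–Lins inputs: the symmetry `racahSum k a b j c d i = racahSum k a d i c b j`
(the transposed direction), injectivity of the eigenvalue `E_i = [(d+i-a)/2][(a+i-d)/2+1]` on a level-`k` range, the
symmetric kernel (detailed balance `v_j D_j = v_{j+2} C_{j+2}` for the weight `v_j`), and the nowhere-vanishing extremal
row. [cite: GasperRahman2004, §7.1 (7.1.8)–(7.1.9)] [cite: KauffmanLins1994, §9.11, §7.3 Prop. 9]
-/

noncomputable section

namespace Literature.RepresentationTheory.ModularTensorCategories.SU2LevelK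

open Finset

/-! ### The abstract spectral lemma -/

section Spectral

variable {F : Type*} [Field F]

/-- Column orthogonality from an intertwining with a symmetric kernel: if `Λ_j w_i T_{ij} = Σ_{i'} K_{ii'} T_{i'j}` with
`K` symmetric on `I`, then `(Λ_j - Λ_{j'}) Σ_i w_i T_{ij} T_{ij'} = 0`. [cite: GasperRahman2004, §7.1 (7.1.8)] -/
theorem gram_mul_eigen_sub {I J : Finset ℕ} {T K : ℕ → ℕ → F} {w Λ : ℕ → F}
    (hKsym : ∀ i ∈ I, ∀ i' ∈ I, K i i' = K i' i)
    (hcol : ∀ j ∈ J, ∀ i ∈ I, Λ j * w i * T i j = ∑ i' ∈ I, K i i' * T i' j) {j j' : ℕ} (hj : j ∈ J) (hj' : j' ∈ J) :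
    (Λ j - Λ j') * ∑ i ∈ I, w i * T i j * T i j' = 0 := by
  have h1 : Λ j * ∑ i ∈ I, w i * T i j * T i j' = ∑ i ∈ I, ∑ i' ∈ I, K i i' * T i' j * T i j' := by
    rw [mul_sum]
    refine sum_congr rfl fun i hi => ?_
    rw [show Λ j * (w i * T i j * T i j') = (Λ j * w i * T i j) * T i j' by ring, hcol j hj i hi, sum_mul]
  have h2 : Λ j' * ∑ i ∈ I, w i * T i j * T i j' = ∑ i ∈ I, ∑ i' ∈ I, K i i' * T i' j * T i j' := by
    rw [mul_sum]
    calc ∑ i ∈ I, Λ j' * (w i * T i j * T i j') = ∑ i ∈ I, ∑ i' ∈ I, T i j * (K i i' * T i' j') := by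
          refine sum_congr rfl fun i hi => ?_
          rw [show Λ j' * (w i * T i j * T i j') = T i j * (Λ j' * w i * T i j') by ring, hcol j' hj' i hi, mul_sum]
      _ = ∑ i' ∈ I, ∑ i ∈ I, T i j * (K i i' * T i' j') := sum_comm
      _ = ∑ i ∈ I, ∑ i' ∈ I, K i i' * T i' j * T i j' := by
          refine sum_congr rfl fun i hi => sum_congr rfl fun i' hi' => ?_
          rw [hKsym i' hi' i hi]; ring
  rw [sub_mul, h1, h2, sub_self]

/-- **Finite spectral lemma** (orthogonality by columns with the predicted norms): under the two symmetric
intertwinings (`hrow`, `hcol`) with injective eigenvalues, a nowhere-vanishing row `i₀` and one normalised column `j₀`,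
`Σ_i w_i T_{ij} T_{ij'} = δ_{jj'}·u_j⁻¹` for `j, j' ∈ J`. [cite: GasperRahman2004, §7.1 (7.1.8)–(7.1.10)] -/
theorem gram_eq_of_threeTerm {I J : Finset ℕ} {T K K' : ℕ → ℕ → F} {w u E Λ : ℕ → F}
    (hKsym : ∀ i ∈ I, ∀ i' ∈ I, K i i' = K i' i) (hK'sym : ∀ j ∈ J, ∀ j' ∈ J, K' j j' = K' j' j)
    (hrow : ∀ i ∈ I, ∀ j ∈ J, E i * u j * T i j = ∑ j' ∈ J, K' j j' * T i j')
    (hcol : ∀ j ∈ J, ∀ i ∈ I, Λ j * w i * T i j = ∑ i' ∈ I, K i i' * T i' j)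
    (hE : ∀ i ∈ I, ∀ i' ∈ I, E i = E i' → i = i') (hΛ : ∀ j ∈ J, ∀ j' ∈ J, Λ j = Λ j' → j = j')
    {i₀ : ℕ} (hi₀ : i₀ ∈ I) (hT : ∀ j ∈ J, T i₀ j ≠ 0)
    {j₀ : ℕ} (hj₀ : j₀ ∈ J) (hu₀ : u j₀ ≠ 0) (hnorm : ∑ i ∈ I, w i * T i j₀ * T i j₀ = (u j₀)⁻¹)
    {j j' : ℕ} (hj : j ∈ J) (hj' : j' ∈ J) :
    ∑ i ∈ I, w i * T i j * T i j' = if j = j' then (u j)⁻¹ else 0 := by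
  -- (1) columns are `w`-orthogonal, (2) rows are `u`-orthogonal
  have colOrth : ∀ j₁ ∈ J, ∀ j₂ ∈ J, j₁ ≠ j₂ → ∑ i ∈ I, w i * T i j₁ * T i j₂ = 0 := by
    intro j₁ h₁ j₂ h₂ hne
    have := gram_mul_eigen_sub hKsym hcol h₁ h₂
    rcases mul_eq_zero.mp this with h | h
    · exact absurd (hΛ j₁ h₁ j₂ h₂ (sub_eq_zero.mp h)) hne
    · exact h
  have rowOrth : ∀ i₁ ∈ I, ∀ i₂ ∈ I, i₁ ≠ i₂ → ∑ j ∈ J, u j * T i₁ j * T i₂ j = 0 := by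
    intro i₁ h₁ i₂ h₂ hne
    have := gram_mul_eigen_sub (I := J) (J := I) (T := fun j i => T i j) (K := K') (w := u) (Λ := E)
      hK'sym (fun i hi j hj => hrow i hi j hj) h₁ h₂
    rcases mul_eq_zero.mp this with h | h
    · exact absurd (hE i₁ h₁ i₂ h₂ (sub_eq_zero.mp h)) hne
    · exact h
  -- (3) the cross identity `u_j N_j T_{ij} = w_i N'_i T_{ij}`
  set N : ℕ → F := fun jj => ∑ i ∈ I, w i * T i jj * T i jj with hN
  set N' : ℕ → F := fun ii => ∑ jj ∈ J, u jj * T ii jj * T ii jj with hN'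
  have cross : ∀ i ∈ I, ∀ jj ∈ J, u jj * N jj * T i jj = w i * N' i * T i jj := by
    intro i hi jj hjj
    have eA : ∑ j'' ∈ J, ∑ i'' ∈ I, u j'' * T i j'' * (w i'' * T i'' j'' * T i'' jj) = u jj * N jj * T i jj := by
      rw [sum_eq_single_of_mem jj hjj]
      · rw [hN]; simp only; rw [mul_sum, sum_mul]
        refine sum_congr rfl fun i'' _ => by ring
      · intro j'' hj'' hne
        rw [← mul_sum, colOrth j'' hj'' jj hjj hne, mul_zero]
    have eB : ∑ j'' ∈ J, ∑ i'' ∈ I, u j'' * T i j'' * (w i'' * T i'' j'' * T i'' jj) = w i * N' i * T i jj := by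
      rw [sum_comm, sum_eq_single_of_mem i hi]
      · rw [hN']; simp only; rw [mul_sum, sum_mul]
        refine sum_congr rfl fun j'' _ => by ring
      · intro i'' hi'' hne
        have h0 := rowOrth i hi i'' hi'' (Ne.symm hne)
        calc ∑ j'' ∈ J, u j'' * T i j'' * (w i'' * T i'' j'' * T i'' jj)
            = (w i'' * T i'' jj) * ∑ j'' ∈ J, u j'' * T i j'' * T i'' j'' := by
              rw [mul_sum]; refine sum_congr rfl fun j'' _ => by ring
          _ = 0 := by rw [h0, mul_zero]
    rw [← eA, eB]
  -- (4) the constant `κ = w_{i₀} N'_{i₀}` equals `u_j N_j` for every `j`, and `κ = 1` from the column `j₀`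
  have hκ : ∀ jj ∈ J, u jj * N jj = w i₀ * N' i₀ := by
    intro jj hjj
    have := cross i₀ hi₀ jj hjj
    exact mul_right_cancel₀ (hT jj hjj) this
  have hκ1 : w i₀ * N' i₀ = 1 := by
    rw [← hκ j₀ hj₀]
    have : N j₀ = (u j₀)⁻¹ := hnorm
    rw [this, mul_inv_cancel₀ hu₀]
  -- conclude
  split_ifs with hjj
  · subst hjj
    have h1 : u j * N j = 1 := (hκ j hj).trans hκ1
    have hu : u j ≠ 0 := by intro h; rw [h, zero_mul] at h1; exact zero_ne_one h1
    have : N j = (u j)⁻¹ := by field_simp; linear_combination h1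
    exact this
  · exact colOrth j hj j' hj' hjj

end Spectral


variable (k : ℕ)

/-! ### Kauffman–Lins inputs: symmetry, level vanishing, single-term rows, eigenvalue injectivity, weights -/

/-- The Racah sum is symmetric under the transposition of the two free labels together with `b ↔ d`:
`racahSum k a b j c d i = racahSum k a d i c b j` (the `αᵢ` are permuted, the `βₖ` fixed). [cite: KauffmanLins1994, §9.11] -/
theorem racahSum_transpose (a b c d i j : ℕ) : racahSum k a b j c d i = racahSum k a d i c b j := by
  unfold racahSum
  simp only
  rw [show i + c + b = b + c + i by omega, show d + c + j = j + c + d by omega, show a + j + b = a + b + j by omega,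
    show a + d + c + b = a + b + c + d by omega, show a + i + c + j = a + j + c + i by omega,
    show d + i + b + j = b + j + d + i by omega, show a + d + i = a + i + d by omega]
  generalize (a + b + j) / 2 = α₁
  generalize (j + c + d) / 2 = α₂
  generalize (b + c + i) / 2 = α₃
  generalize (a + i + d) / 2 = α₄
  generalize (a + b + c + d) / 2 = β₁
  generalize (a + j + c + i) / 2 = β₂
  generalize (b + j + d + i) / 2 = β₃
  rw [show max (max α₄ α₃) (max α₂ α₁) = max (max α₁ α₂) (max α₃ α₄) by
    rw [max_comm (max α₄ α₃) (max α₂ α₁), max_comm α₄ α₃, max_comm α₂ α₁]]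
  refine sum_congr rfl fun z _ => ?_
  ring

/-- The Racah sum is symmetric under `(a,b,c,d) ↦ (b,a,d,c)`. [cite: KauffmanLins1994, §9.11] -/
theorem racahSum_swap12 (a b c d i j : ℕ) : racahSum k b a j d c i = racahSum k a b j c d i := by
  unfold racahSum
  simp only
  rw [show b + a + j = a + b + j by omega, show j + d + c = j + c + d by omega, show b + a + d + c = a + b + c + d by omega,
    show a + d + i = a + i + d by omega, show b + i + c = b + c + i by omega]
  generalize (a + b + j) / 2 = α₁
  generalize (j + c + d) / 2 = α₂
  generalize (b + c + i) / 2 = α₃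
  generalize (a + i + d) / 2 = α₄
  generalize (a + b + c + d) / 2 = β₁
  generalize (a + j + c + i) / 2 = β₂
  generalize (b + j + d + i) / 2 = β₃
  rw [show max (max α₁ α₂) (max α₄ α₃) = max (max α₁ α₂) (max α₃ α₄) by rw [max_comm α₄ α₃],
    show min (min β₁ β₃) β₂ = min (min β₁ β₂) β₃ by rw [min_assoc, min_comm β₃ β₂, ← min_assoc]]
  refine sum_congr rfl fun z _ => ?_
  ring

/-- The Racah sum is symmetric under `(a,b,c,d) ↦ (c,d,a,b)`. [cite: KauffmanLins1994, §9.11] -/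
theorem racahSum_swap13 (a b c d i j : ℕ) : racahSum k c d j a b i = racahSum k a b j c d i := by
  unfold racahSum
  simp only
  rw [show c + d + j = j + c + d by omega, show j + a + b = a + b + j by omega, show d + a + i = a + i + d by omega,
    show c + i + b = b + c + i by omega, show c + d + a + b = a + b + c + d by omega,
    show c + j + a + i = a + j + c + i by omega, show d + j + b + i = b + j + d + i by omega]
  generalize (a + b + j) / 2 = α₁
  generalize (j + c + d) / 2 = α₂
  generalize (b + c + i) / 2 = α₃
  generalize (a + i + d) / 2 = α₄
  generalize (a + b + c + d) / 2 = β₁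
  generalize (a + j + c + i) / 2 = β₂
  generalize (b + j + d + i) / 2 = β₃
  rw [show max (max α₂ α₁) (max α₄ α₃) = max (max α₁ α₂) (max α₃ α₄) by rw [max_comm α₂ α₁, max_comm α₄ α₃]]
  refine sum_congr rfl fun z _ => ?_
  ring

/-- `[n]! = 0` for `n ≥ k + 2` (it contains the factor `[k+2] = 0`). [cite: KauffmanLins1994, §9.8] -/
theorem qFactorial_eq_zero_of_le {n : ℕ} (h : k + 2 ≤ n) : qFactorial k n = 0 := by
  unfold qFactorial
  exact prod_eq_zero (i := k + 1) (mem_range.mpr (by omega)) (qInt_level k)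

/-- The Racah sum vanishes beyond the level: if `(a + b + j)/2 ≥ k + 1` then every term contains `[z+1]!` with
`z + 1 ≥ k + 2`. [cite: KauffmanLins1994, §9.8, §9.11] -/
theorem racahSum_eq_zero_of_level {a b c d i j : ℕ} (h : k + 1 ≤ (a + b + j) / 2) : racahSum k a b j c d i = 0 := by
  unfold racahSum
  simp only
  refine sum_eq_zero fun z hz => ?_
  rw [mem_Icc] at hz
  have h1 : (a + b + j) / 2 ≤ z := ((le_max_left _ _).trans (le_max_left _ _)).trans hz.1
  have h2 : k + 2 ≤ z + 1 := Nat.succ_le_succ (h.trans h1)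
  rw [qFactorial_eq_zero_of_le k h2, mul_zero, zero_div]

/-- The same for the triad `(c,d,j)`. [cite: KauffmanLins1994, §9.8, §9.11] -/
theorem racahSum_eq_zero_of_level' {a b c d i j : ℕ} (h : k + 1 ≤ (j + c + d) / 2) : racahSum k a b j c d i = 0 := by
  unfold racahSum
  simp only
  refine sum_eq_zero fun z hz => ?_
  rw [mem_Icc] at hz
  have h1 : (j + c + d) / 2 ≤ z := ((le_max_right _ _).trans (le_max_left _ _)).trans hz.1
  have h2 : k + 2 ≤ z + 1 := Nat.succ_le_succ (h.trans h1)
  rw [qFactorial_eq_zero_of_le k h2, mul_zero, zero_div]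

/-- The extremal row index `i_min = max(|a-d|, |b-c|)`. [cite: KauffmanLins1994, §9.11] -/
def imin (a b c d : ℕ) : ℕ := max (max (a - d) (d - a)) (max (b - c) (c - b))

/-- `i_min` dominates the four differences and is one of them. [folklore] -/
theorem imin_spec (a b c d : ℕ) :
    (a ≤ d + imin a b c d ∧ d ≤ a + imin a b c d ∧ b ≤ c + imin a b c d ∧ c ≤ b + imin a b c d) ∧
      (imin a b c d + d = a ∨ imin a b c d + a = d ∨ imin a b c d + c = b ∨ imin a b c d + b = c) := by
  unfold imin
  rcases le_total a d with h1 | h1 <;> rcases le_total b c with h2 | h2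
  · rw [Nat.sub_eq_zero_of_le h1, Nat.sub_eq_zero_of_le h2, max_eq_right (Nat.zero_le _),
      max_eq_right (Nat.zero_le _)]
    rcases le_total (d - a) (c - b) with h3 | h3
    · rw [max_eq_right h3]; omega
    · rw [max_eq_left h3]; omega
  · rw [Nat.sub_eq_zero_of_le h1, Nat.sub_eq_zero_of_le h2, max_eq_right (Nat.zero_le _),
      max_eq_left (Nat.zero_le _)]
    rcases le_total (d - a) (b - c) with h3 | h3
    · rw [max_eq_right h3]; omega
    · rw [max_eq_left h3]; omega
  · rw [Nat.sub_eq_zero_of_le h1, Nat.sub_eq_zero_of_le h2, max_eq_left (Nat.zero_le _),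
      max_eq_right (Nat.zero_le _)]
    rcases le_total (a - d) (c - b) with h3 | h3
    · rw [max_eq_right h3]; omega
    · rw [max_eq_left h3]; omega
  · rw [Nat.sub_eq_zero_of_le h1, Nat.sub_eq_zero_of_le h2, max_eq_left (Nat.zero_le _),
      max_eq_left (Nat.zero_le _)]
    rcases le_total (a - d) (b - c) with h3 | h3
    · rw [max_eq_right h3]; omega
    · rw [max_eq_left h3]; omega

/-- `i_min` is level-`k` admissible with `(a,d)` and `(b,c)` as soon as some `j` is admissible with `(a,b)` and `(c,d)`.
[folklore] -/
theorem adm_imin {a b c d j : ℕ} (habj : Adm k a b j) (hcdj : Adm k c d j) :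
    Adm k a d (imin a b c d) ∧ Adm k b c (imin a b c d) := by
  have hs := imin_spec a b c d
  generalize imin a b c d = m at hs
  obtain ⟨⟨h1, h2, h3, h4⟩, heq⟩ := hs
  unfold Adm at *
  rcases heq with h | h | h | h <;> omega

/-- A Racah sum one of whose `β`'s equals one of its `α`'s is a single non-zero term (all factorial arguments stay
`≤ k`). This is the case for the extremal rows `i ∈ {a-d, d-a, b-c, c-b}`. [cite: KauffmanLins1994, §9.11] -/
theorem racahSum_ne_zero_of_extremal {a b c d i j : ℕ} (hadi : Adm k a d i) (hbci : Adm k b c i) (habj : Adm k a b j)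
    (hcdj : Adm k c d j) (hex : i + d = a ∨ i + a = d ∨ i + c = b ∨ i + b = c) : racahSum k a b j c d i ≠ 0 := by
  unfold Adm at hadi hbci habj hcdj
  obtain ⟨pa, ta1, ta2, ta3, la⟩ := hadi
  obtain ⟨pb, tb1, tb2, tb3, lb⟩ := hbci
  obtain ⟨pc, tc1, tc2, tc3, lc⟩ := habj
  obtain ⟨pd, td1, td2, td3, ld⟩ := hcdj
  unfold racahSum
  simp only
  -- the window is the single point `z₀ = max α = min β`
  have hge : min (min ((a + b + c + d) / 2) ((a + j + c + i) / 2)) ((b + j + d + i) / 2) ≤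
      max (max ((a + b + j) / 2) ((j + c + d) / 2)) (max ((b + c + i) / 2) ((a + i + d) / 2)) := by
    rcases hex with h | h | h | h
    · calc _ ≤ (b + j + d + i) / 2 := min_le_right _ _
        _ = (a + b + j) / 2 := by clear tb1 tb2 tb3 tc1 tc2 tc3 td1 td2 td3 pa pb pc pd; omega
        _ ≤ _ := (le_max_left _ _).trans (le_max_left _ _)
    · calc _ ≤ (a + j + c + i) / 2 := (min_le_left _ _).trans (min_le_right _ _)
        _ = (j + c + d) / 2 := by clear tb1 tb2 tb3 tc1 tc2 tc3 td1 td2 td3 pa pb pc pd; omega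
        _ ≤ _ := (le_max_right _ _).trans (le_max_left _ _)
    · calc _ ≤ (a + j + c + i) / 2 := (min_le_left _ _).trans (min_le_right _ _)
        _ = (a + b + j) / 2 := by clear ta1 ta2 ta3 tc1 tc2 tc3 td1 td2 td3 pa pb pc pd; omega
        _ ≤ _ := (le_max_left _ _).trans (le_max_left _ _)
    · calc _ ≤ (b + j + d + i) / 2 := min_le_right _ _
        _ = (j + c + d) / 2 := by clear ta1 ta2 ta3 tc1 tc2 tc3 td1 td2 td3 pa pb pc pd; omega
        _ ≤ _ := (le_max_right _ _).trans (le_max_left _ _)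
  clear hex
  have hle : max (max ((a + b + j) / 2) ((j + c + d) / 2)) (max ((b + c + i) / 2) ((a + i + d) / 2)) ≤
      min (min ((a + b + c + d) / 2) ((a + j + c + i) / 2)) ((b + j + d + i) / 2) := by
    refine le_min (le_min ?_ ?_) ?_ <;> refine max_le (max_le ?_ ?_) (max_le ?_ ?_) <;> omega
  have htop := le_antisymm hge hle
  clear hge hle
  -- bounds on `z₀`
  have hz1 : (a + b + j) / 2 ≤ max (max ((a + b + j) / 2) ((j + c + d) / 2)) (max ((b + c + i) / 2) ((a + i + d) / 2)) :=
    (le_max_left _ _).trans (le_max_left _ _)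
  have hz2 : (j + c + d) / 2 ≤ max (max ((a + b + j) / 2) ((j + c + d) / 2)) (max ((b + c + i) / 2) ((a + i + d) / 2)) :=
    (le_max_right _ _).trans (le_max_left _ _)
  have hz3 : (b + c + i) / 2 ≤ max (max ((a + b + j) / 2) ((j + c + d) / 2)) (max ((b + c + i) / 2) ((a + i + d) / 2)) :=
    (le_max_left _ _).trans (le_max_right _ _)
  have hzk : max (max ((a + b + j) / 2) ((j + c + d) / 2)) (max ((b + c + i) / 2) ((a + i + d) / 2)) ≤ k := by
    refine max_le (max_le ?_ ?_) (max_le ?_ ?_) <;> omega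
  rw [htop, Icc_self, sum_singleton]
  clear htop
  generalize max (max ((a + b + j) / 2) ((j + c + d) / 2)) (max ((b + c + i) / 2) ((a + i + d) / 2)) = z₀ at *
  have h5 : (a + b + c + d) / 2 - z₀ ≤ k + 1 := by omega
  have h6 : (a + j + c + i) / 2 - z₀ ≤ k + 1 := by omega
  have h7 : (b + j + d + i) / 2 - z₀ ≤ k + 1 := by omega
  have h8 : z₀ + 1 ≤ k + 1 := by omega
  have h9 : ∀ x : ℕ, z₀ - x ≤ k + 1 := fun x => (Nat.sub_le _ _).trans (by omega)
  apply div_ne_zero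
  · exact mul_ne_zero (pow_ne_zero _ (by norm_num)) (qFactorial_pos k h8).ne'
  · exact mul_ne_zero (mul_ne_zero (mul_ne_zero (mul_ne_zero (mul_ne_zero (mul_ne_zero
      (qFactorial_pos k (h9 _)).ne' (qFactorial_pos k (h9 _)).ne') (qFactorial_pos k (h9 _)).ne')
      (qFactorial_pos k (h9 _)).ne') (qFactorial_pos k h5).ne') (qFactorial_pos k h6).ne') (qFactorial_pos k h7).ne'

/-- The extremal row is a single non-zero term: `racahSum k a b j c d i_min ≠ 0` for admissible `j`.
[cite: KauffmanLins1994, §9.11] -/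
theorem racahSum_imin_ne_zero {a b c d j : ℕ} (habj : Adm k a b j) (hcdj : Adm k c d j) :
    racahSum k a b j c d (imin a b c d) ≠ 0 :=
  racahSum_ne_zero_of_extremal k (adm_imin k habj hcdj).1 (adm_imin k habj hcdj).2 habj hcdj (imin_spec a b c d).2

/-- The eigenvalue in closed form: `E_i = (cos((a-d+1)θ) - cos((i+1)θ)) / (2 sin²θ)`, `θ = π/(k+2)`, for `i` with
`(a,d,i)` of even sum and satisfying the triangle inequalities. [cite: GasperRahman2004, §7.2 (7.2.9)] -/
theorem racahE_eq_cos {a d i : ℕ} (h : (a + d + i) % 2 = 0 ∧ a ≤ d + i ∧ d ≤ i + a) :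
    racahE k a d i = (Real.cos (((a : ℝ) - d + 1) * (Real.pi / (k + 2))) - Real.cos (((i : ℝ) + 1) * (Real.pi / (k + 2)))) /
      (2 * Real.sin (Real.pi / (k + 2)) ^ 2) := by
  unfold racahE qInt
  have hs := sin_klAngle_ne_zero k
  have hx : (((d + i - a) / 2 : ℕ) : ℝ) = ((d : ℝ) + i - a) / 2 := by
    rw [Nat.cast_div (by omega) (by norm_num)]; push_cast [Nat.cast_sub (by omega : a ≤ d + i)]; ring
  have hy : (((a + i - d) / 2 + 1 : ℕ) : ℝ) = ((a : ℝ) + i - d) / 2 + 1 := by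
    push_cast
    rw [Nat.cast_div (by omega) (by norm_num)]; push_cast [Nat.cast_sub (by omega : d ≤ a + i)]; ring
  rw [hx, hy]
  set θ := Real.pi / ((k : ℝ) + 2) with hθ
  rw [show ((d : ℝ) + i - a) / 2 * Real.pi / (k + 2) = ((d : ℝ) + i - a) / 2 * θ by rw [hθ]; ring,
    show (((a : ℝ) + i - d) / 2 + 1) * Real.pi / (k + 2) = (((a : ℝ) + i - d) / 2 + 1) * θ by rw [hθ]; ring]
  have hprod : ∀ X Y : ℝ, Real.sin X * Real.sin Y = (Real.cos (X - Y) - Real.cos (X + Y)) / 2 := by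
    intro X Y; rw [Real.cos_sub, Real.cos_add]; ring
  rw [div_mul_div_comm, hprod, show ((d : ℝ) + i - a) / 2 * θ - (((a : ℝ) + i - d) / 2 + 1) * θ = -(((a : ℝ) - d + 1) * θ)
      by ring, show ((d : ℝ) + i - a) / 2 * θ + (((a : ℝ) + i - d) / 2 + 1) * θ = ((i : ℝ) + 1) * θ by ring, Real.cos_neg]
  field_simp

/-- The eigenvalues `E_i` are pairwise distinct on the admissible rows (`cos` is injective on `[0, π]` and
`(i+1)π/(k+2) ∈ (0, π)` for `i ≤ k`). [folklore] -/
theorem racahE_injective {a d i i' : ℕ} (hi : (a + d + i) % 2 = 0 ∧ a ≤ d + i ∧ d ≤ i + a ∧ i ≤ k)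
    (hi' : (a + d + i') % 2 = 0 ∧ a ≤ d + i' ∧ d ≤ i' + a ∧ i' ≤ k) (h : racahE k a d i = racahE k a d i') : i = i' := by
  rw [racahE_eq_cos k ⟨hi.1, hi.2.1, hi.2.2.1⟩, racahE_eq_cos k ⟨hi'.1, hi'.2.1, hi'.2.2.1⟩] at h
  have hs := sin_klAngle_ne_zero k
  have hden : (2 * Real.sin (Real.pi / (k + 2)) ^ 2) ≠ 0 := by positivity
  rw [div_left_inj' hden, sub_right_inj] at h
  have hk : (0 : ℝ) < k + 2 := by positivity
  have mem : ∀ n : ℕ, n ≤ k → ((n : ℝ) + 1) * (Real.pi / (k + 2)) ∈ Set.Icc 0 Real.pi := by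
    intro n hn
    constructor
    · positivity
    · rw [← mul_div_assoc, div_le_iff₀ hk]
      have : (n : ℝ) + 1 ≤ k + 2 := by exact_mod_cast (by omega : n + 1 ≤ k + 2)
      nlinarith [Real.pi_pos]
  have := Real.injOn_cos (mem i hi.2.2.2) (mem i' hi'.2.2.2) h
  have hθ : Real.pi / (k + 2) ≠ 0 := by positivity
  have : (i : ℝ) + 1 = i' + 1 := by
    have := mul_right_cancel₀ hθ this
    linarith
  exact_mod_cast (by linarith : (i : ℝ) = i')

/-- The weight `v_j = [j+1]·[(b+j-a)/2]![(d+j-c)/2]![(c+j-d)/2]![(a+j-b)/2]![(c+d-j)/2]![(a+b-j)/2]! / ([(a+b+j)/2+1]![(c+d+j)/2+1]!)`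
making the `j`-recurrence symmetric (`v_j D_j = v_{j+2} C_{j+2}`); the weight for the rows is `v` of the transposed
labels `(a,d,c,b)`. [cite: GasperRahman2004, §7.2 eq. (7.2.3), (7.2.15) (in Kauffman–Lins' normalisation)] -/
def racahV (a b c d j : ℕ) : ℝ :=
  qInt k (j + 1) * (qFactorial k ((b + j - a) / 2) * qFactorial k ((d + j - c) / 2) * qFactorial k ((c + j - d) / 2) *
    qFactorial k ((a + j - b) / 2) * qFactorial k ((c + d - j) / 2) * qFactorial k ((a + b - j) / 2)) /
    (qFactorial k ((a + b + j) / 2 + 1) * qFactorial k ((c + d + j) / 2 + 1))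

/-- `v_j ≠ 0` on admissible `j`. [folklore] -/
theorem racahV_ne_zero {a b c d j : ℕ} (habj : Adm k a b j) (hcdj : Adm k c d j) : racahV k a b c d j ≠ 0 := by
  unfold Adm at habj hcdj
  unfold racahV
  apply div_ne_zero
  · refine mul_ne_zero (qInt_ne_zero k (by omega) (by omega)) ?_
    exact mul_ne_zero (mul_ne_zero (mul_ne_zero (mul_ne_zero (mul_ne_zero (qFactorial_pos k (by omega)).ne'
      (qFactorial_pos k (by omega)).ne') (qFactorial_pos k (by omega)).ne') (qFactorial_pos k (by omega)).ne')
      (qFactorial_pos k (by omega)).ne') (qFactorial_pos k (by omega)).ne'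
  · exact mul_ne_zero (qFactorial_pos k (by omega)).ne' (qFactorial_pos k (by omega)).ne'

/-- `v` is symmetric under `(a,b,c,d) ↦ (b,a,d,c)` and `↦ (c,d,a,b)`. [folklore] -/
theorem racahV_swap12 (a b c d j : ℕ) : racahV k b a d c j = racahV k a b c d j := by
  unfold racahV; rw [show b + a + j = a + b + j by omega, show d + c + j = c + d + j by omega,
    show b + a - j = a + b - j by omega, show d + c - j = c + d - j by omega]; ring

/-- `v` is symmetric under `(a,b,c,d) ↦ (c,d,a,b)`. [folklore] -/
theorem racahV_swap13 (a b c d j : ℕ) : racahV k c d a b j = racahV k a b c d j := by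
  unfold racahV; ring

/-- **Detailed balance**: `v_{j+2} C_{j+2} = v_j D_j` for `j, j+2` admissible — the kernel `K'(j,j+2) = v_j D_j` of the
`j`-recurrence is symmetric. [cite: GasperRahman2004, §7.1 (7.1.7) (v_n = Π A_{k-1}/C_k)] -/
theorem racahV_balance {a b c d j : ℕ} (habj : Adm k a b j) (hcdj : Adm k c d j) (habj2 : Adm k a b (j + 2))
    (hcdj2 : Adm k c d (j + 2)) :
    racahV k a b c d (j + 2) * racahCco k a b c d (j + 2) = racahV k a b c d j * racahDco k a b c d j := by
  unfold Adm at habj hcdj habj2 hcdj2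
  unfold racahV racahCco racahDco
  rw [show (b + (j + 2) - a) / 2 = (b + j - a) / 2 + 1 by omega, show (d + (j + 2) - c) / 2 = (d + j - c) / 2 + 1 by omega,
    show (c + (j + 2) - d) / 2 = (c + j - d) / 2 + 1 by omega, show (a + (j + 2) - b) / 2 = (a + j - b) / 2 + 1 by omega,
    show (a + b + (j + 2)) / 2 + 1 = ((a + b + j) / 2 + 1) + 1 by omega,
    show (c + d + (j + 2)) / 2 + 1 = ((c + d + j) / 2 + 1) + 1 by omega,
    show (c + d - j) / 2 = (c + d - (j + 2)) / 2 + 1 by omega, show (a + b - j) / 2 = (a + b - (j + 2)) / 2 + 1 by omega,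
    show j + 2 + 1 = j + 3 by omega]
  have h1 : qInt k (j + 1) ≠ 0 := qInt_ne_zero k (by omega) (by omega)
  have h2 : qInt k (j + 2) ≠ 0 := qInt_ne_zero k (by omega) (by omega)
  have h3 : qInt k (j + 3) ≠ 0 := qInt_ne_zero k (by omega) (by omega)
  have hA : qFactorial k ((a + b + j) / 2 + 1) ≠ 0 := (qFactorial_pos k (by omega)).ne'
  have hC : qFactorial k ((c + d + j) / 2 + 1) ≠ 0 := (qFactorial_pos k (by omega)).ne'
  have hA1 : qInt k ((a + b + j) / 2 + 1 + 1) ≠ 0 := qInt_ne_zero k (by omega) (by omega)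
  have hC1 : qInt k ((c + d + j) / 2 + 1 + 1) ≠ 0 := qInt_ne_zero k (by omega) (by omega)
  -- expand the eight shifted factorials `[x+1]! = [x]! [x+1]`
  rw [qFactorial_succ k ((b + j - a) / 2), qFactorial_succ k ((d + j - c) / 2), qFactorial_succ k ((c + j - d) / 2),
    qFactorial_succ k ((a + j - b) / 2), qFactorial_succ k ((c + d - (j + 2)) / 2),
    qFactorial_succ k ((a + b - (j + 2)) / 2), qFactorial_succ k ((a + b + j) / 2 + 1),
    qFactorial_succ k ((c + d + j) / 2 + 1)]
  rw [div_mul_div_comm, div_mul_div_comm, div_eq_div_iff]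
  · ring
  · exact mul_ne_zero (mul_ne_zero (mul_ne_zero hA hA1) (mul_ne_zero hC hC1)) (mul_ne_zero h2 h3)
  · exact mul_ne_zero (mul_ne_zero hA hC) (mul_ne_zero h1 h2)

/-! ### The symmetric tridiagonal kernels and the two intertwining relations -/

/-- A tridiagonal kernel on the even lattice: `K(j,j+2) = K(j+2,j) = f j`, `K(j,j) = g j`, `0` otherwise. [folklore] -/
def tridiagKernel (f g : ℕ → ℝ) (j j' : ℕ) : ℝ :=
  (if j' = j + 2 then f j else 0) + (if j' + 2 = j then f j' else 0) + (if j' = j then g j else 0)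

/-- The tridiagonal kernel is symmetric. [folklore] -/
theorem tridiagKernel_symm (f g : ℕ → ℝ) (j j' : ℕ) : tridiagKernel f g j j' = tridiagKernel f g j' j := by
  unfold tridiagKernel
  by_cases h1 : j' = j + 2
  · subst h1
    simp [show j + 2 + 2 ≠ j by omega, show j ≠ j + 2 + 2 by omega]
  · by_cases h2 : j' + 2 = j
    · subst h2
      simp [show j' ≠ j' + 2 + 2 by omega, show j' + 2 + 2 ≠ j' by omega]
    · by_cases h3 : j' = j
      · subst h3; rfl
      · rw [if_neg h1, if_neg h2, if_neg h3, if_neg (fun h => h2 h.symm), if_neg (fun h => h1 h.symm),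
          if_neg (fun h => h3 h.symm)]

/-- The action of the tridiagonal kernel on a row: `Σ_{j'∈J} K(j,j') T(j') = [j+2∈J] f j T(j+2) + [2≤j ∧ j-2∈J] f (j-2) T(j-2) + [j∈J] g j T(j)`.
[folklore] -/
theorem tridiagKernel_sum (f g T : ℕ → ℝ) (J : Finset ℕ) (j : ℕ) (hj : j ∈ J) :
    ∑ j' ∈ J, tridiagKernel f g j j' * T j' =
      (if j + 2 ∈ J then f j * T (j + 2) else 0) + (if 2 ≤ j ∧ j - 2 ∈ J then f (j - 2) * T (j - 2) else 0) +
        g j * T j := by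
  unfold tridiagKernel
  simp only [add_mul, sum_add_distrib, ite_mul, zero_mul]
  rw [sum_ite_eq' J (j + 2) (fun j' => f j * T j'), sum_ite_eq' J j (fun j' => g j * T j'), if_pos hj]
  congr 1
  congr 1
  by_cases h2 : 2 ≤ j
  · have : ∀ j' ∈ J, (if j' + 2 = j then f j' * T j' else 0) = (if j' = j - 2 then f (j - 2) * T (j - 2) else 0) := by
      intro j' _
      by_cases h : j' + 2 = j
      · rw [if_pos h, if_pos (by omega), show j - 2 = j' by omega]
      · rw [if_neg h, if_neg (by omega)]
    rw [sum_congr rfl this, sum_ite_eq']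
    by_cases hm : j - 2 ∈ J
    · rw [if_pos hm, if_pos ⟨h2, hm⟩]
    · rw [if_neg hm, if_neg (fun h => hm h.2)]
  · rw [if_neg (fun h => h2 h.1)]
    exact sum_eq_zero fun j' _ => if_neg (by omega)

/-- The admissible rows `I = {i ≤ k : (a,d,i), (b,c,i) admissible}` of the Gram problem for `(a,b,c,d)`.
[cite: KauffmanLins1994, §9.12 ("sum over q-admissibles")] -/
def rowSet (a b c d : ℕ) : Finset ℕ := (range (k + 1)).filter fun i => Adm k a d i ∧ Adm k b c i

/-- The admissible columns `J = {j ≤ k : (a,b,j), (c,d,j) admissible}`. [cite: KauffmanLins1994, §9.12] -/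
def colSet (a b c d : ℕ) : Finset ℕ := (range (k + 1)).filter fun j => Adm k a b j ∧ Adm k c d j

/-- Membership in `rowSet`. [folklore] -/
theorem mem_rowSet {a b c d i : ℕ} : i ∈ rowSet k a b c d ↔ i ≤ k ∧ Adm k a d i ∧ Adm k b c i := by
  unfold rowSet; rw [mem_filter, mem_range, Nat.lt_succ_iff]

/-- Membership in `colSet`. [folklore] -/
theorem mem_colSet {a b c d j : ℕ} : j ∈ colSet k a b c d ↔ j ≤ k ∧ Adm k a b j ∧ Adm k c d j := by
  unfold colSet; rw [mem_filter, mem_range, Nat.lt_succ_iff]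

/-- The columns of the transposed labels `(a,d,c,b)` are the rows of `(a,b,c,d)`. [folklore] -/
theorem colSet_transpose (a b c d : ℕ) : colSet k a d c b = rowSet k a b c d := by
  unfold colSet rowSet
  refine filter_congr fun i _ => ?_
  rw [show Adm k c b i ↔ Adm k b c i from adm_comm k]

/-- The rows of the transposed labels are the columns. [folklore] -/
theorem rowSet_transpose (a b c d : ℕ) : rowSet k a d c b = colSet k a b c d := by
  unfold colSet rowSet
  refine filter_congr fun j _ => ?_
  rw [show Adm k d c j ↔ Adm k c d j from adm_comm k]

/-- The kernel `K'(j,j') = v_j D_j` (`j' = j ± 2`), `v_j B_j` (`j' = j`) of the `j`-recurrence for labels `(a,b,c,d)`. [folklore] -/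
def racahKernel (a b c d : ℕ) (j j' : ℕ) : ℝ :=
  tridiagKernel (fun j => racahV k a b c d j * racahDco k a b c d j) (fun j => racahV k a b c d j * racahBco k a b c d j) j j'

/-- **The intertwining relation of the rows** (the `j`-recurrence in symmetric-kernel form): for `i ∈ I`, `j ∈ J`,
`E_i v_j S_{ij} = Σ_{j'∈J} K'(j,j') S_{ij'}`. [cite: GasperRahman2004, §7.2 eq. (7.2.1)] [cite: KauffmanLins1994, §9.11] -/
theorem racahSum_intertwine (hk : 1 ≤ k) {a b c d i j : ℕ} (hi : i ∈ rowSet k a b c d) (hj : j ∈ colSet k a b c d) :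
    racahE k a d i * racahV k a b c d j * racahSum k a b j c d i =
      ∑ j' ∈ colSet k a b c d, racahKernel k a b c d j j' * racahSum k a b j' c d i := by
  rw [mem_rowSet] at hi
  rw [mem_colSet] at hj
  obtain ⟨hik, hadi, hbci⟩ := hi
  obtain ⟨hjk, habj, hcdj⟩ := hj
  unfold racahKernel
  rw [tridiagKernel_sum _ _ _ _ _ ((mem_colSet k).mpr ⟨hjk, habj, hcdj⟩)]
  have rel := racahSum_rel k hk hadi hbci habj hcdj
  -- the upper neighbour
  have hup : racahV k a b c d j * racahDco k a b c d j * racahSumUp k a b c d i j =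
      (if j + 2 ∈ colSet k a b c d then racahV k a b c d j * racahDco k a b c d j * racahSum k a b (j + 2) c d i else 0) := by
    by_cases hm : j + 2 ∈ colSet k a b c d
    · rw [if_pos hm]
      rw [mem_colSet] at hm
      unfold racahSumUp
      rw [if_pos ⟨((adm_iff_tri k).mp hm.2.1).1, ((adm_iff_tri k).mp hm.2.2).1⟩]
    · rw [if_neg hm]
      unfold racahSumUp
      split_ifs with ht
      · rw [mem_colSet, not_and_or, not_and_or] at hm
        have hlev : k + 1 ≤ (a + b + (j + 2)) / 2 ∨ k + 1 ≤ (j + 2 + c + d) / 2 := by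
          unfold Tri at ht; unfold Adm at hm habj hcdj; omega
        rcases hlev with h | h
        · rw [racahSum_eq_zero_of_level k h, mul_zero]
        · rw [racahSum_eq_zero_of_level' k h, mul_zero]
      · rw [mul_zero]
  -- the lower neighbour, with detailed balance
  have hdown : racahV k a b c d j * racahCco k a b c d j * racahSumDown k a b c d i j =
      (if 2 ≤ j ∧ j - 2 ∈ colSet k a b c d then
        racahV k a b c d (j - 2) * racahDco k a b c d (j - 2) * racahSum k a b (j - 2) c d i else 0) := by
    by_cases hm : 2 ≤ j ∧ j - 2 ∈ colSet k a b c d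
    · rw [if_pos hm]
      obtain ⟨h2, hm⟩ := hm
      rw [mem_colSet] at hm
      unfold racahSumDown
      rw [if_pos ⟨h2, ((adm_iff_tri k).mp hm.2.1).1, ((adm_iff_tri k).mp hm.2.2).1⟩]
      obtain ⟨j', rfl⟩ : ∃ j', j = j' + 2 := ⟨j - 2, by omega⟩
      rw [show j' + 2 - 2 = j' by omega] at hm ⊢
      rw [racahV_balance k hm.2.1 hm.2.2 habj hcdj]
    · rw [if_neg hm]
      unfold racahSumDown
      split_ifs with ht
      · exfalso
        apply hm
        refine ⟨ht.1, (mem_colSet k).mpr ⟨by omega, ?_, ?_⟩⟩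
        · rw [adm_iff_tri]; unfold Adm at habj; exact ⟨ht.2.1, by omega⟩
        · rw [adm_iff_tri]; unfold Adm at hcdj; exact ⟨ht.2.2, by omega⟩
      · rw [mul_zero]
  calc racahE k a d i * racahV k a b c d j * racahSum k a b j c d i
      = racahV k a b c d j * (racahE k a d i * racahSum k a b j c d i) := by ring
    _ = racahV k a b c d j * racahDco k a b c d j * racahSumUp k a b c d i j +
          racahV k a b c d j * racahCco k a b c d j * racahSumDown k a b c d i j +
          racahV k a b c d j * racahBco k a b c d j * racahSum k a b j c d i := by rw [rel]; ring
    _ = _ := by rw [hup, hdown]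

/-- **Orthogonality of the Kauffman–Lins Racah sums with the predicted norms, given one normalised column**:
for `(a,b,c,d)` at level `k ≥ 1`, if some column `j₀ ∈ J` has `Σ_{i∈I} ṽ_i S_{ij₀}² = v_{j₀}⁻¹`, then for all `j, j' ∈ J`
`Σ_{i∈I} ṽ_i S_{ij} S_{ij'} = δ_{jj'} v_j⁻¹` (`ṽ_i = racahV k a d c b i`, `v_j = racahV k a b c d j`,
`S_{ij} = racahSum k a b j c d i`). [cite: KauffmanLins1994, §7.3 Prop. 9] [cite: GasperRahman2004, §7.2 (7.2.15)–(7.2.18)] -/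
theorem racahSum_gram_of_norm (hk : 1 ≤ k) {a b c d : ℕ} {j₀ : ℕ} (hj₀ : j₀ ∈ colSet k a b c d)
    (hnorm : ∑ i ∈ rowSet k a b c d, racahV k a d c b i * racahSum k a b j₀ c d i * racahSum k a b j₀ c d i =
      (racahV k a b c d j₀)⁻¹)
    {j j' : ℕ} (hj : j ∈ colSet k a b c d) (hj' : j' ∈ colSet k a b c d) :
    ∑ i ∈ rowSet k a b c d, racahV k a d c b i * racahSum k a b j c d i * racahSum k a b j' c d i =
      if j = j' then (racahV k a b c d j)⁻¹ else 0 := by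
  have hj₀' := (mem_colSet k).mp hj₀
  -- the extremal row
  have hi₀ : imin a b c d ∈ rowSet k a b c d := by
    rw [mem_rowSet]
    have h := adm_imin k hj₀'.2.1 hj₀'.2.2
    exact ⟨by unfold Adm at h; omega, h.1, h.2⟩
  refine gram_eq_of_threeTerm (I := rowSet k a b c d) (J := colSet k a b c d)
    (T := fun i j => racahSum k a b j c d i) (K := fun i i' => racahKernel k a d c b i i')
    (K' := fun j j' => racahKernel k a b c d j j') (w := fun i => racahV k a d c b i) (u := fun j => racahV k a b c d j)
    (E := fun i => racahE k a d i) (Λ := fun j => racahE k a b j)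
    (fun i _ i' _ => tridiagKernel_symm _ _ i i') (fun j _ j' _ => tridiagKernel_symm _ _ j j')
    (fun i hi j hj => racahSum_intertwine k hk hi hj) ?_ ?_ ?_ hi₀ ?_ hj₀ (racahV_ne_zero k hj₀'.2.1 hj₀'.2.2) hnorm hj hj'
  · -- columns: the intertwining relation of the transposed labels `(a,d,c,b)`
    intro j hj i hi
    have hi' : i ∈ colSet k a d c b := by rw [colSet_transpose]; exact hi
    have hj' : j ∈ rowSet k a d c b := by rw [rowSet_transpose]; exact hj
    have h := racahSum_intertwine k hk hj' hi'
    simp only [← racahSum_transpose k] at h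
    rw [colSet_transpose] at h
    exact h
  · intro i hi i' hi' h
    rw [mem_rowSet] at hi hi'
    unfold Adm at hi hi'
    exact racahE_injective k ⟨hi.2.1.1, hi.2.1.2.2.1, hi.2.1.2.2.2.1, hi.1⟩
      ⟨hi'.2.1.1, hi'.2.1.2.2.1, hi'.2.1.2.2.2.1, hi'.1⟩ h
  · intro j hj j' hj' h
    rw [mem_colSet] at hj hj'
    unfold Adm at hj hj'
    exact racahE_injective k ⟨hj.2.1.1, hj.2.1.2.2.1, hj.2.1.2.2.2.1, hj.1⟩
      ⟨hj'.2.1.1, hj'.2.1.2.2.1, hj'.2.1.2.2.2.1, hj'.1⟩ h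
  · intro j hj
    rw [mem_colSet] at hj
    exact racahSum_imin_ne_zero k hj.2.1 hj.2.2

end Literature.RepresentationTheory.ModularTensorCategories.SU2LevelK
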